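import Summits.SmoothPoincare4.SmoothPoincare4.Theses.EntropyRung
import Summits.SmoothPoincare4.SmoothPoincare4.Theorems.EntropyRungSubcylindricalExistenceConformalRealisation
import Literature.Geometry.Riemannian.RiemannianCoveringVolume
import Literature.Geometry.Riemannian.GurskyViaclovskyCovariantBoundsNaturality
import Literature.Geometry.Lorentzian.CurvatureNaturality
import Literature.Geometry.Lorentzian.IsometryProofs
import Literature.Geometry.Lorentzian.LeviCivitaProofs
import Literature.Geometry.Lorentzian.MetricLocality
import Literature.Geometry.Lorentzian.RiemannianMeasureComparison
import Literature.Geometry.Lorentzian.VolumeChartFormula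
import HarnessLib

/-!
# Transport along the core identification `ι : P → M ∖ {p}` (aux for stub `stub_floorBridge`,
line `fat-conical-core-avr-logsobolev`, crux `EntropyRung.SubcylindricalExistence`,
stmt-SmoothPoincare4-10871)

The registered helper `helper_stub_floorBridge_gauge`: for a closed Riemannian 4-manifold
`(M, g)`, a manifold `(P, h)` identified with `({p}ᶜ, Λ²g)` by an inverse pair
`ι : P → M`, `σ : M → P` (`ι` a smooth injective immersion onto `{p}ᶜ`, `σ` smooth on `{p}ᶜ`,
`h = ι^*(Λ²g)` pointwise), and a smooth positive `Φ` on `M` with `Φ = Λ` on an open `U`: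
(i) `∫_P f∘ι dV_h = ∫_M f Φ⁴ dV_g` for every `f` vanishing off `U`; (ii)
`|∇(w∘ι)|²_h = Φ⁻²|∇w|²_g ∘ ι` on `ι⁻¹U`; (iii) `R_h = Φ⁻³(R_gΦ − 6Δ_gΦ) ∘ ι` on `ι⁻¹U`.

Proof: `g̃ = Φ²g` is a smooth metric on `M` (`ConformalRealisation.exists_isRiemannian_conformal_sq`)
and `h̃ = ι^*g̃` (`PseudoRiemannianMetric.comap`) agrees with `h` on `ι⁻¹U`; then
* `ι : (P, h̃) → (M, g̃)` is an injective local isometry onto the co-null open set `{p}ᶜ`, hence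
  `ι_* μ_{h̃} = μ_{g̃}` (`map_riemannianMeasure_of_localIsometry`: locally distance preserving,
  `RiemannianCovering.exists_nhds_edist_comp_eq`, so volume preserving on small sets,
  `riemannianMeasure_image_eq_of_subset`, globalised over a countable cover; points are null,
  `riemannianMeasure_singleton`);
* `μ_h = μ_{h̃}` on `ι⁻¹U` (`riemannianMeasure_restrict_congr_of_inner_eq`: the density
  `√det(h̃⁻¹h)` of `riemannianMeasure_eq_withDensity_sqrt_det_endo` is `1` there) and
  `dV_{g̃} = Φ⁴dV_g` (`riemannianMeasure_eq_withDensity_of_conformal_sq_four`);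
* `|∇·|²` and `R` are pointwise local in the metric (`gradSq_eq_of_eqOn`,
  `scalarCurvature_eq_of_eqOn`), natural under `ι` (`gradSq_comap`, `scalarCurvature_comap`) and
  obey the conformal laws (`gradSq_of_conformal`, `scalarCurvature_conformal_sq_four`).
Everything is proved; no definition, no named fact.

References: B. O'Neill, *Semi-Riemannian geometry* (1983), Ch. 3, pp. 90–91, Prop. 3.59
[ONeill1983]; H. Federer, *Geometric Measure Theory* (1969), §2.10.11, §3.2.46 [Federer1969];
I. Chavel, *Riemannian Geometry* (2006), §III.3 [Chavel2006].
-/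

noncomputable section

open scoped Manifold ContDiff Topology ENNReal NNReal
open Bundle Topology Set Filter Function MeasureTheory Measure
open Literature.Geometry.Lorentzian Literature.Geometry.Riemannian

set_option linter.dupNamespace false

namespace Summit.SmoothPoincare4.SmoothPoincare4.Theorems

namespace StubFloorBridgeAux

open Literature.Geometry.Lorentzian.PseudoRiemannianMetric

/-! ## Riemannian measures of metrics agreeing on a set; points are null -/

section MeasureAgree

variable {H : Type*} [TopologicalSpace H] {n : ℕ∞ω} {m : ℕ}
  {I : ModelWithCorners ℝ (EuclideanSpace ℝ (Fin m)) H}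
  {N : Type*} [TopologicalSpace N] [ChartedSpace H N] [IsManifold I ∞ N] [T3Space N]
  [MeasurableSpace N] [BorelSpace N] [SecondCountableTopology N]
  (h h' : ContMDiffRiemannianMetric I n (EuclideanSpace ℝ (Fin m)) (TangentSpace I : N → Type _))

/-- **Riemannian measures of metrics agreeing on a measurable set agree there**: if `h = h'` on
`Ω` then `μ_h|_Ω = μ_{h'}|_Ω` (the density `√det(h'⁻¹ h)` of `dμ_h = √det(h'⁻¹h) dμ_{h'}`,
`riemannianMeasure_eq_withDensity_sqrt_det_endo`, equals `1` on `Ω`). Chavel 2006, §III.3.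
[cite: Chavel2006, §III.3 (III.3.5)–(III.3.6)] -/
theorem riemannianMeasure_restrict_congr_of_inner_eq {Ω : Set N} (hΩm : MeasurableSet Ω)
    (heq : ∀ x ∈ Ω, h.inner x = h'.inner x) :
    (riemannianMeasure h).restrict Ω = (riemannianMeasure h').restrict Ω := by
  rw [riemannianMeasure_eq_withDensity_sqrt_det_endo h h', restrict_withDensity hΩm]
  have hid : ∀ x ∈ Ω, ((ofRiemannian h').sharp x).toLinearMap ∘ₗ (ofRiemannian h).toBilinForm x =
      LinearMap.id := by
    intro x hx
    refine LinearMap.ext fun v ↦ ?_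
    have hflat : (ofRiemannian h).toBilinForm x v = (ofRiemannian h').flat x v := by
      refine LinearMap.ext fun w ↦ ?_
      rw [toBilinForm_apply, flat_apply]
      change h.inner x v w = h'.inner x v w
      rw [heq x hx]
    simp only [LinearMap.coe_comp, LinearEquiv.coe_coe, Function.comp_apply, LinearMap.id_coe,
      id_eq, hflat, sharp_flat]
  have hae : (fun p ↦ ENNReal.ofReal (Real.sqrt (LinearMap.det
      (((ofRiemannian h').sharp p).toLinearMap ∘ₗ (ofRiemannian h).toBilinForm p)))) =ᵐ[
      (riemannianMeasure h').restrict Ω] fun _ ↦ 1 := by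
    filter_upwards [ae_restrict_mem hΩm] with p hp
    rw [hid p hp, LinearMap.det_id, Real.sqrt_one, ENNReal.ofReal_one]
  rw [withDensity_congr_ae hae]
  exact withDensity_one

omit [SecondCountableTopology N] in
/-- **Points are null for the Riemannian measure** (chart formula on the singleton `{x}`, whose
chart image is a Lebesgue-null singleton of `ℝ^m`, `m ≥ 1`). [cite: Federer1969, §3.2.46] -/
theorem riemannianMeasure_singleton [NeZero m] (x : N) :
    riemannianMeasure h {x} = 0 := by
  have h1 := riemannianMeasure_eq_integral_sqrt_det_holds h x (measurableSet_singleton x)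
    (singleton_subset_iff.2 (mem_extChartAt_source x))
  rw [h1, image_singleton]
  exact setLIntegral_measure_zero _ _ (measure_singleton _)

end MeasureAgree

/-! ## Injective local isometries onto co-null open sets are measure preserving -/

section LocalIsometry

variable {E₁ : Type*} [NormedAddCommGroup E₁] [NormedSpace ℝ E₁] [FiniteDimensional ℝ E₁]
  {H₁ : Type*} [TopologicalSpace H₁] {I₁ : ModelWithCorners ℝ E₁ H₁}
  {M₁ : Type*} [TopologicalSpace M₁] [ChartedSpace H₁ M₁] [IsManifold I₁ ∞ M₁]
  {E₂ : Type*} [NormedAddCommGroup E₂] [NormedSpace ℝ E₂] [FiniteDimensional ℝ E₂]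
  {H₂ : Type*} [TopologicalSpace H₂] {I₂ : ModelWithCorners ℝ E₂ H₂}
  {M₂ : Type*} [TopologicalSpace M₂] [ChartedSpace H₂ M₂] [IsManifold I₂ ∞ M₂]
  {g₁ : PseudoRiemannianMetric I₁ ∞ E₁ (TangentSpace I₁ : M₁ → Type _)}
  {g₂ : PseudoRiemannianMetric I₂ ∞ E₂ (TangentSpace I₂ : M₂ → Type _)}
  {F : M₁ → M₂}
  [T3Space M₁] [MeasurableSpace M₁] [BorelSpace M₁] [SecondCountableTopology M₁]
  [T3Space M₂] [MeasurableSpace M₂] [BorelSpace M₂]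

/-- **An injective local isometry onto a co-null open set pushes the Riemannian measure forward
to the Riemannian measure**: if `F : (M₁, g₁) → (M₂, g₂)` is `C^∞`, injective, a local
diffeomorphism with `g₂(dF v, dF w) = g₁(v, w)`, `dim M₁ = dim M₂`, and `Vol_{g₂}((range F)ᶜ) = 0`,
then `F_* Vol_{g₁} = Vol_{g₂}`. Locally `F` preserves the Riemannian distance
(`RiemannianCovering.exists_nhds_edist_comp_eq`), hence the volume of small sets
(`riemannianMeasure_image_eq_of_subset`, Federer 1969, §2.10.11); a countable cover by such
neighbourhoods globalises this on `range F`. [cite: Federer1969, §2.10.11 and §3.2.46] -/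
theorem map_riemannianMeasure_of_localIsometry (hg₁ : g₁.IsRiemannian) (hg₂ : g₂.IsRiemannian)
    (hF : ContMDiff I₁ I₂ ∞ F) (hinj : Injective F) (hloc : IsLocalDiffeomorph I₁ I₂ ∞ F)
    (hiso : ∀ (x : M₁) (v w : TangentSpace I₁ x),
      g₂.val (F x) (mfderiv I₁ I₂ F x v) (mfderiv I₁ I₂ F x w) = g₁.val x v w)
    (hdim : Module.finrank ℝ E₁ = Module.finrank ℝ E₂)
    (hnull : riemannianMeasure (g₂.toContMDiffRiemannianMetric hg₂) (range F)ᶜ = 0) :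
    (riemannianMeasure (g₁.toContMDiffRiemannianMetric hg₁)).map F =
      riemannianMeasure (g₂.toContMDiffRiemannianMetric hg₂) := by
  set μ₁ := riemannianMeasure (g₁.toContMDiffRiemannianMetric hg₁) with hμ₁
  set μ₂ := riemannianMeasure (g₂.toContMDiffRiemannianMetric hg₂) with hμ₂
  have hF1 : ContMDiff I₁ I₂ 1 F := hF.of_le (by exact_mod_cast (le_top : (1 : ℕ∞) ≤ ⊤))
  choose U hUo hxU _hinjU hUiso using fun x : M₁ ↦
    RiemannianCovering.exists_nhds_edist_comp_eq hg₁ hg₂ hF1 hiso (hloc x)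
  have hcont : Continuous F := hF.continuous
  have hemb : MeasurableEmbedding F :=
    (IsOpenEmbedding.of_continuous_injective_isOpenMap hcont hinj hloc.isOpenMap).measurableEmbedding
  -- a countable subcover of the distance-preserving neighbourhoods
  obtain ⟨T, hTc, hTU⟩ := TopologicalSpace.isOpen_iUnion_countable U hUo
  have hTuniv : ⋃ x ∈ T, U x = univ := by
    rw [hTU]
    exact iUnion_eq_univ_iff.2 fun z ↦ ⟨z, hxU z⟩
  -- on `range F`
  have hrangeF : MeasurableSet (range F) := hloc.isOpen_range.measurableSet
  have hrange : (μ₁.map F).restrict (range F) = μ₂.restrict (range F) := by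
    have himage : range F = ⋃ x ∈ T, F '' U x := by
      rw [← image_iUnion₂, hTuniv, image_univ]
    rw [himage]
    refine (restrict_biUnion_congr hTc).2 fun x _ ↦ ?_
    refine Measure.ext fun B hB ↦ ?_
    have hFU : MeasurableSet (F '' U x) := hemb.measurableSet_image' (hUo x).measurableSet
    rw [Measure.restrict_apply hB, Measure.restrict_apply hB,
      Measure.map_apply hcont.measurable (hB.inter hFU), preimage_inter,
      hinj.preimage_image, ← image_preimage_inter]
    exact (RiemannianCovering.riemannianMeasure_image_eq_of_subset hg₁ hg₂ (hUiso x)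
      inter_subset_right hdim).symm
  -- on `(range F)ᶜ` both restrictions vanish
  have hcompl : (μ₁.map F).restrict (range F)ᶜ = μ₂.restrict (range F)ᶜ := by
    rw [Measure.restrict_eq_zero.2 hnull, Measure.restrict_eq_zero.2]
    rw [Measure.map_apply hcont.measurable hrangeF.compl, preimage_compl, preimage_range,
      compl_univ, measure_empty]
  rw [← restrict_add_restrict_compl (μ := μ₁.map F) hrangeF, hrange, hcompl,
    restrict_add_restrict_compl hrangeF]

/-- **Change of variables along an injective local isometry onto a co-null open set**:
`∫ f ∘ F dVol_{g₁} = ∫ f dVol_{g₂}` for every `f` (`F` is a measurable embedding, being an open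
embedding). [cite: Federer1969, §2.10.11 and §3.2.46] -/
theorem integral_comp_of_localIsometry (hg₁ : g₁.IsRiemannian) (hg₂ : g₂.IsRiemannian)
    (hF : ContMDiff I₁ I₂ ∞ F) (hinj : Injective F) (hloc : IsLocalDiffeomorph I₁ I₂ ∞ F)
    (hiso : ∀ (x : M₁) (v w : TangentSpace I₁ x),
      g₂.val (F x) (mfderiv I₁ I₂ F x v) (mfderiv I₁ I₂ F x w) = g₁.val x v w)
    (hdim : Module.finrank ℝ E₁ = Module.finrank ℝ E₂)
    (hnull : riemannianMeasure (g₂.toContMDiffRiemannianMetric hg₂) (range F)ᶜ = 0) (f : M₂ → ℝ) :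
    ∫ x, f (F x) ∂riemannianMeasure (g₁.toContMDiffRiemannianMetric hg₁) =
      ∫ y, f y ∂riemannianMeasure (g₂.toContMDiffRiemannianMetric hg₂) := by
  have hemb : MeasurableEmbedding F :=
    (IsOpenEmbedding.of_continuous_injective_isOpenMap hF.continuous hinj
      hloc.isOpenMap).measurableEmbedding
  have hmp : MeasurePreserving F (riemannianMeasure (g₁.toContMDiffRiemannianMetric hg₁))
      (riemannianMeasure (g₂.toContMDiffRiemannianMetric hg₂)) :=
    ⟨hF.continuous.measurable,
      map_riemannianMeasure_of_localIsometry hg₁ hg₂ hF hinj hloc hiso hdim hnull⟩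
  exact hmp.integral_comp hemb f

end LocalIsometry

/-! ## The identification `ι : P → M ∖ {p}` and the conformal gauge frozen near a closed set -/

section Gauge

variable {M : Type} [TopologicalSpace M] [T2Space M] [SecondCountableTopology M]
  [ChartedSpace (EuclideanSpace ℝ (Fin 4)) M] [IsManifold (𝓡 4) ∞ M] [CompactSpace M]
  [T3Space M] [MeasurableSpace M] [BorelSpace M]
  {P : Type} [TopologicalSpace P] [T2Space P] [SecondCountableTopology P]
  [ChartedSpace (EuclideanSpace ℝ (Fin 4)) P] [IsManifold (𝓡 4) ∞ P]
  [T3Space P] [MeasurableSpace P] [BorelSpace P]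

omit [SecondCountableTopology M] [IsManifold (𝓡 4) ∞ M] [CompactSpace M] [T3Space M]
  [MeasurableSpace M] [BorelSpace M] [T2Space P] [SecondCountableTopology P] [IsManifold (𝓡 4) ∞ P]
  [T3Space P] [MeasurableSpace P] [BorelSpace P] in
/-- A smooth injection `ι : P → M` onto `{p}ᶜ` with an inverse `σ` smooth on `{p}ᶜ` is a `C^∞`
local diffeomorphism (the pair `(ι, σ)` is a `PartialDiffeomorph` with source `P`). [folklore] -/
theorem isLocalDiffeomorph_of_inverse {ι : P → M} {σ : M → P} {p : M}
    (hι : ContMDiff (𝓡 4) (𝓡 4) ∞ ι) (hrange : range ι = {p}ᶜ)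
    (hσ : ContMDiffOn (𝓡 4) (𝓡 4) ∞ σ {p}ᶜ) (hσι : ∀ q, σ (ι q) = q)
    (hισ : ∀ x, x ≠ p → ι (σ x) = x) :
    IsLocalDiffeomorph (𝓡 4) (𝓡 4) ∞ ι := by
  let e : PartialDiffeomorph (𝓡 4) (𝓡 4) P M ∞ :=
    { toFun := ι
      invFun := σ
      source := univ
      target := {p}ᶜ
      map_source' := fun q _ ↦ by rw [← hrange]; exact mem_range_self q
      map_target' := fun _ _ ↦ mem_univ _
      left_inv' := fun q _ ↦ hσι q
      right_inv' := fun x hx ↦ hισ x hx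
      open_source := isOpen_univ
      open_target := isOpen_compl_singleton
      contMDiffOn_toFun := hι.contMDiffOn
      contMDiffOn_invFun := hσ }
  exact fun q ↦ ⟨e, mem_univ q, fun _ _ ↦ rfl⟩

end Gauge

end StubFloorBridgeAux

open StubFloorBridgeAux Literature.Geometry.Lorentzian.PseudoRiemannianMetric in
/-- **Consequences of the frozen gauge** (registered helper `helper_stub_floorBridge_gauge`, aux
for stub `stub_floorBridge`). Let `g` (Levi-Civita, Riemannian) on the closed `M`,
`h` (Levi-Civita, Riemannian) on `P`, `ι : P → M` a smooth injective immersion onto `{p}ᶜ` with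
inverse `σ` smooth on `{p}ᶜ` and `h = ι^*(Λ²g)` pointwise, and let `Φ > 0` be smooth on `M` with
`Φ = Λ` on the open `U`. With `g̃ = Φ²g` (`exists_isRiemannian_conformal_sq`) and `h̃ = ι^*g̃`
(`comap`, `= h` on `ι⁻¹U`): (i) `∫_P f∘ι dV_h = ∫_M f Φ⁴ dV_g` for `f` vanishing off `U`
(`μ_h = μ_{h̃}` on `ι⁻¹U`, `ι_* μ_{h̃} = μ_{g̃}`, `dV_{g̃} = Φ⁴dV_g`); (ii)
`|∇(w∘ι)|²_h = Φ⁻²|∇w|²_g ∘ ι` on `ι⁻¹U` (`gradSq_comap`, `gradSq_of_conformal`); (iii)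
`R_h = Φ⁻³(R_gΦ − 6Δ_gΦ) ∘ ι` on `ι⁻¹U` (`scalarCurvature_comap`,
`scalarCurvature_conformal_sq_four`). [cite: ONeill1983, Ch. 3, Prop. 3.59] -/
theorem helper_stub_floorBridge_gauge : ∀ (M : Type) [TopologicalSpace M] [T2Space M] [ChartedSpace (EuclideanSpace ℝ (Fin 4)) M] [IsManifold (𝓡 4) ∞ M] [CompactSpace M] [T3Space M] [MeasurableSpace M] [BorelSpace M] (P : Type) [TopologicalSpace P] [SecondCountableTopology P] [ChartedSpace (EuclideanSpace ℝ (Fin 4)) P] [IsManifold (𝓡 4) ∞ P] [T3Space P] [MeasurableSpace P] [BorelSpace P] (g : PseudoRiemannianMetric (𝓡 4) ∞ (EuclideanSpace ℝ (Fin 4)) (TangentSpace (𝓡 4) : M → Type _)) [g.HasLeviCivita] (hg : g.IsRiemannian) (p : M) (h : PseudoRiemannianMetric (𝓡 4) ∞ (EuclideanSpace ℝ (Fin 4)) (TangentSpace (𝓡 4) : P → Type _)) [h.HasLeviCivita] (hh : h.IsRiemannian) (ι : P → M) (σ : M → P) (Λ Φ : M → ℝ) (U : Set M), ContMDiff (𝓡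 4) (𝓡 4) ∞ ι → Injective ι → (∀ q : P, Injective (mfderiv (𝓡 4) (𝓡 4) ι q)) → range ι = {p}ᶜ → ContMDiffOn (𝓡 4) (𝓡 4) ∞ σ {p}ᶜ → (∀ q : P, σ (ι q) = q) → (∀ x : M, x ≠ p → ι (σ x) = x) → (∀ (q : P) (v w : TangentSpace (𝓡 4) q), h.val q v w = Λ (ι q) ^ 2 * g.val (ι q) (mfderiv (𝓡 4) (𝓡 4) ι q v) (mfderiv (𝓡 4) (𝓡 4) ι q w)) → ContMDiff (𝓡 4) 𝓘(ℝ, ℝ) ∞ Φ → (∀ x : M, 0 < Φ x) → IsOpen U → (∀ x ∈ U, Φ x = Λ x) → (∀ f : M → ℝ, (∀ x ∉ U, f x = 0) → ∫ q, f (ι q) ∂(riemannianMeasure (h.toContMDiffRiemannianMetric hh)) = ∫ x, f x * Φ x ^ 4 ∂(riemannianMeasure (g.toContMDiffRiemannianMetric hg))) ∧ (∀ w : M → ℝ, ContMDiff (𝓡 4) 𝓘(ℝ, ℝ) ∞ w → ∀ q : P, ι q ∈ U → h.gradSq (fun q ↦ w (ι q)) q = (Φ (ι q))⁻¹ ^ 2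 * g.gradSq w (ι q)) ∧ ∀ q : P, ι q ∈ U → h.scalarCurvature q = (Φ (ι q) ^ 3)⁻¹ * (g.scalarCurvature (ι q) * Φ (ι q) - 6 * g.dalembertian Φ (ι q)) := by
  intro M _ _ _ _ _ _ _ _ P _ _ _ _ _ _ _ g _ hg p h _ hh ι σ Λ Φ U hι hinj hι' hrange hσ hσι hισ hval hΦ
    hΦpos hU hΦΛ
  -- the global conformal metric `g̃ = Φ² g` and its pullback `h̃ = ι^* g̃`
  obtain ⟨g', hg', hval'⟩ := ConformalRealisation.exists_isRiemannian_conformal_sq g hg hΦ hΦpos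
  haveI : g'.HasLeviCivita := g'.hasLeviCivita
  have hι1 : ContMDiff (𝓡 4) (𝓡 4) ((∞ : ℕ∞ω) + 1) ι := hι
  set h' := g'.comap PseudoRiemannianMetric.contMDiff_pullbackBilin_holds ι hι1 hι' rfl with hh'def
  haveI : h'.HasLeviCivita := h'.hasLeviCivita
  have hiso : ∀ (q : P) (v w : TangentSpace (𝓡 4) q),
      g'.val (ι q) (mfderiv (𝓡 4) (𝓡 4) ι q v) (mfderiv (𝓡 4) (𝓡 4) ι q w) = h'.val q v w :=
    fun q v w ↦ rfl
  have hh'R : h'.IsRiemannian := by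
    intro q v hv
    rw [← hiso]
    refine hg' _ _ fun h0 ↦ hv (hι' q ?_)
    rw [map_zero]
    exact h0
  -- `h̃ = h` on `ι⁻¹ U`
  have hagree : ∀ q ∈ ι ⁻¹' U, h'.val q = h.val q := by
    intro q hq
    ext v w
    rw [← hiso, hval', hval, hΦΛ _ hq]
  have hUo' : IsOpen (ι ⁻¹' U) := hU.preimage hι.continuous
  have hloc : IsLocalDiffeomorph (𝓡 4) (𝓡 4) ∞ ι :=
    isLocalDiffeomorph_of_inverse hι hrange hσ hσι hισ
  refine ⟨fun f hf ↦ ?_, fun w hw q hq ↦ ?_, fun q hq ↦ ?_⟩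
  · have hfι : ∀ q, q ∉ ι ⁻¹' U → f (ι q) = 0 := fun q hq ↦ hf _ hq
    -- `μ_h = μ_{h̃}` on `ι⁻¹ U`
    have h1 : ∫ q, f (ι q) ∂riemannianMeasure (h.toContMDiffRiemannianMetric hh) =
        ∫ q, f (ι q) ∂riemannianMeasure (h'.toContMDiffRiemannianMetric hh'R) := by
      rw [← setIntegral_eq_integral_of_forall_compl_eq_zero (s := ι ⁻¹' U) hfι,
        ← setIntegral_eq_integral_of_forall_compl_eq_zero (s := ι ⁻¹' U)
          (μ := riemannianMeasure (h'.toContMDiffRiemannianMetric hh'R)) hfι,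
        riemannianMeasure_restrict_congr_of_inner_eq (h.toContMDiffRiemannianMetric hh)
          (h'.toContMDiffRiemannianMetric hh'R) hUo'.measurableSet fun q hq ↦ ?_]
      change h.val q = h'.val q
      exact (hagree q hq).symm
    -- `ι_* μ_{h̃} = μ_{g̃}`
    have hnull : riemannianMeasure (g'.toContMDiffRiemannianMetric hg') (range ι)ᶜ = 0 := by
      rw [hrange, compl_compl]
      exact riemannianMeasure_singleton _ p
    have h2 : ∫ q, f (ι q) ∂riemannianMeasure (h'.toContMDiffRiemannianMetric hh'R) =
        ∫ x, f x ∂riemannianMeasure (g'.toContMDiffRiemannianMetric hg') :=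
      integral_comp_of_localIsometry hh'R hg' hι hinj hloc hiso rfl hnull f
    -- `dV_{g̃} = Φ⁴ dV_g`
    have hvol : riemannianMeasure (g'.toContMDiffRiemannianMetric hg') =
        (riemannianMeasure (g.toContMDiffRiemannianMetric hg)).withDensity
          fun x ↦ ENNReal.ofReal (Φ x ^ 4) :=
      riemannianMeasure_eq_withDensity_of_conformal_sq_four _ _ hΦ.continuous.measurable
        fun x v w ↦ by
          rw [toContMDiffRiemannianMetric_inner, toContMDiffRiemannianMetric_inner, hval']
    have hmeas : Measurable fun x ↦ ENNReal.ofReal (Φ x ^ 4) :=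
      ENNReal.measurable_ofReal.comp (hΦ.continuous.pow 4).measurable
    have h3 : ∫ x, f x ∂riemannianMeasure (g'.toContMDiffRiemannianMetric hg') =
        ∫ x, f x * Φ x ^ 4 ∂riemannianMeasure (g.toContMDiffRiemannianMetric hg) := by
      rw [hvol, integral_withDensity_eq_integral_toReal_smul hmeas
        (ae_of_all _ fun _ ↦ ENNReal.ofReal_lt_top)]
      refine integral_congr_ae (ae_of_all _ fun x ↦ ?_)
      dsimp only
      rw [ENNReal.toReal_ofReal (by positivity), smul_eq_mul, mul_comm]
    rw [h1, h2, h3]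
  · have hE : h.gradSq (fun q ↦ w (ι q)) q = h'.gradSq (w ∘ ι) q :=
      (gradSq_eq_of_eqOn h h' hagree hq (w ∘ ι)).symm
    rw [hE, GurskyViaclovskyPath.gradSq_comap g' _ hι1 hι' rfl hg' hw q,
      ConformalRealisation.gradSq_of_conformal g g' (φ := fun y ↦ Φ y ^ 2) hval'
        (pow_pos (hΦpos _) 2).ne' w, inv_pow]
  · have hE : h.scalarCurvature q = h'.scalarCurvature q :=
      (scalarCurvature_eq_of_eqOn h h' hUo' hagree hq).symm
    rw [hE, scalarCurvature_comap g' _ hι1 hι' rfl q]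
    have hE4 : Module.finrank ℝ (EuclideanSpace ℝ (Fin 4)) = 4 := finrank_euclideanSpace_fin
    exact scalarCurvature_conformal_sq_four hE4 g g' hΦ hΦpos hval' (ι q)


end Summit.SmoothPoincare4.SmoothPoincare4.Theorems

end
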